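import Mathlib
import Summits.PneNP.PneNP.Theorems.SfmBlParamsFP

/-!
# Parameter glue for the M5 instantiation of `cutCertified_of_pipeline` — line «sfm-bl»

FRONTIER F-N1c; nothing here bears on P vs NP.

Literal rewriting lemmas between the machine's integers and the real-number hypotheses / thresholds of
prover-2's parametric pipeline theorem `SfmBl.cutCertified_of_pipeline` (`SfmBlPipeline`):
* `sfmBl_params_spec_real` — the three side conditions in the CAST form the pipeline takes
  (`(N : ℝ) ≤ 2^b`, `20·(N : ℝ) ≤ 2^(2^(j+1))`, `2·2^(j+1) + 2b ≤ 10(t₀+1)`), for the canonical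
  `b = size N`, `j + 1 = size (size (20N))`, `t₀ = (2·2^(j+1) + 2b)/10` of `SfmBlParamsFP`, with `N` written
  as the real sum `card α + card β` the pipeline uses;
* `sfmBl_A₃_frac` — the spot threshold `A₃ = (6/5)(Σ_s 4(|V₁ s|+|V₂ s|)·((2^60 : ℕ) : ℝ)^10)⁻¹ + 1)` in the
  pipeline's literal shape as ONE fraction `p₂/q₂` of naturals (`V = Σ_s (|V₁ s|+|V₂ s|)`), and
  `sfmBl_A₁_frac'` — the remainder threshold with `N` as the real sum; together with
  `frac_compare_int_iff` (`SfmBlParamsFP`) the greedy step test of M5 is a comparison in `ℤ`.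
-/

namespace Summit.PneNP.PneNP.Theorems.SfmBl

open Finset BigOperators

/-- The three side conditions of `cutCertified_of_pipeline` in its cast form, for the canonical parameters. -/
theorem sfmBl_params_spec_real {Nα Nβ : ℕ} {b j t₀ : ℕ} (hb : b = Nat.size (Nα + Nβ))
    (hj : j + 1 = Nat.size (Nat.size (20 * (Nα + Nβ)))) (ht : t₀ = (2 * 2 ^ (j + 1) + 2 * b) / 10) :
    ((Nα : ℝ) + Nβ) ≤ 2 ^ b ∧ 2 * 2 ^ (j + 1) + 2 * b ≤ 10 * (t₀ + 1) ∧
      20 * ((Nα : ℝ) + Nβ) ≤ 2 ^ (2 ^ (j + 1)) := by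
  obtain ⟨h1, h2, h3⟩ := sfmBl_params_spec (N := Nα + Nβ) hb hj ht
  refine ⟨by exact_mod_cast h1, h3, by exact_mod_cast h2⟩

/-- `A₁` with `N` as the real sum of the two piece counts (the pipeline's literal shape). -/
theorem sfmBl_A₁_frac' (Nα Nβ ℓ : ℕ) :
    (10 : ℝ) * ((((Nα : ℝ) + Nβ)) * ((2 : ℝ) ^ 60 / 20) ^ ℓ + 1)
      = ((10 * ((Nα + Nβ) * 2 ^ (60 * ℓ) + 20 ^ ℓ) : ℕ) : ℝ) / ((20 ^ ℓ : ℕ) : ℝ) := by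
  have h := sfmBl_A₁_frac (Nα + Nβ) ℓ
  push_cast at h ⊢
  exact h

/-- `A₃ = (6/5)(Σ_s 4(|V₁ s|+|V₂ s|)·((2^60 : ℕ) : ℝ)^10)⁻¹ + 1) = 6(4V + (2^60)^10)/(5·(2^60)^10)`,
`V = Σ_s (|V₁ s| + |V₂ s|)` (the pipeline's literal shape of the spot threshold). -/
theorem sfmBl_A₃_frac {r : ℕ} (a b : Fin r → ℕ) :
    (6 : ℝ) / 5 * (∑ s, 4 * ((a s : ℝ) + b s) * ((((2 ^ 60 : ℕ) : ℝ)) ^ 10)⁻¹ + 1)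
      = ((6 * (4 * (∑ s, (a s + b s)) + (2 ^ 60) ^ 10) : ℕ) : ℝ) / ((5 * (2 ^ 60) ^ 10 : ℕ) : ℝ) := by
  have hcast : ((2 ^ 60 : ℕ) : ℝ) = (2 : ℝ) ^ 60 := by norm_num
  have hsum : ∑ s, 4 * ((a s : ℝ) + b s) * ((((2 ^ 60 : ℕ) : ℝ)) ^ 10)⁻¹
      = 4 * ((∑ s, (a s + b s) : ℕ) : ℝ) * (((2 : ℝ) ^ 60) ^ 10)⁻¹ := by
    rw [hcast]
    simp only [Nat.cast_sum, Nat.cast_add, Finset.mul_sum, Finset.sum_mul]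
  rw [hsum]
  exact sfmBl_A₂_frac _

/-- The spot count `V` and the positivity facts the integer comparison needs, in the pipeline's shape. -/
theorem sfmBl_A₃_pos {r : ℕ} (a b : Fin r → ℕ) :
    (0 : ℝ) < 6 / 5 * (∑ s, 4 * ((a s : ℝ) + b s) * ((((2 ^ 60 : ℕ) : ℝ)) ^ 10)⁻¹ + 1) := by
  have : (0 : ℝ) ≤ ∑ s, 4 * ((a s : ℝ) + b s) * ((((2 ^ 60 : ℕ) : ℝ)) ^ 10)⁻¹ :=
    Finset.sum_nonneg fun s _ => by positivity
  positivity

end Summit.PneNP.PneNP.Theorems.SfmBl
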